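import Summits.AtomisticToContinuum.FouriersLaw.Theorems.BondHeatUncertaintySubdiffusiveBondHeatKernelDetailedBalanceLaplaceB

/-!
# Kernel detailed balance (H2), part C: `B_λ(f, h) = B_λ(h∘Θ, f∘Θ)` for test functions, given the density of `(λ - L)C_c^∞`

Support for the registered stub `stub_kernelDetailedBalance` (H2) of crux `stmt-AtomisticToContinuum-9120` (line
`bath-bond-deficit-integral`). Main result of the Laplace part: **if `(λ - L)C_c^∞` is `L²(μ_T)`-dense in `C_c^∞`** (the
registered sub-stub `stub_resolventRangeDense` + Hilbert-space duality), **then for all test functions `f, h`**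
`∫₀^∞ e^{-λt} ⟨f, P_t h⟩_{μ_T} dt = ∫₀^∞ e^{-λt} ⟨h∘Θ, P_t (f∘Θ)⟩_{μ_T} dt`
(`pinnedChain_laplaceDetailedBalance_of_dense`): on the dense ranges both sides are computed by the resolvent identity
(part B) and agree by the static flip-adjointness; the weighted bounds of part A carry the identity to the limit.
-/

noncomputable section

open MeasureTheory ProbabilityTheory Filter Topology Set Function
open scoped NNReal ENNReal ContDiff
open Literature.MathematicalPhysics.KineticTheory.HeatConduction
open Literature.MathematicalPhysics.KineticTheory OscillatorChain
open Summit.AtomisticToContinuum.FouriersLaw.Theorems.OddSectorIrreversibility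
open Summit.AtomisticToContinuum.FouriersLaw.Cruxes.SuperadditiveResistance.FloatingProbeBypassLaplacian
  (integral_flip_gibbsMeasure contDiff_flip hasCompactSupport_flip)

namespace Summit.AtomisticToContinuum.FouriersLaw.Theorems.SubdiffusiveBondHeat

variable {N : ℕ}

section Pinned

variable {ω₂ lam β γ : ℝ} (hω : 0 < ω₂) (hl : 0 ≤ lam) (hβ : 0 < β) (hγ : 0 < γ) (hN : 0 < N)
  {T : ℝ} (hT : 0 < T)
include hω hl hβ hγ hN hT

/-- **The approximation estimate.** If `f', h'` are bounded continuous approximants of the test functions `f, h` in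
`L²(μ_T)` — `∫ (f-f')² ≤ ε²`, `∫ (h-h')² ≤ ε²`, `0 < ε ≤ 1` — on which the flipped Laplace identity holds EXACTLY,
`B_λ(f',h') = B_λ(h'∘Θ, f'∘Θ)`, then `|B_λ(f,h) - B_λ(h∘Θ,f∘Θ)| ≤ (8 + 3∫f² + 3∫h²) ε/(2λ)` (additivity of `B_λ` and the
weighted Cauchy–Schwarz bound of part A). [folklore] -/
theorem pinnedChain_lap_flip_approx {lam' : ℝ} (hlam : 0 < lam') {f h f' h' : PhaseSpace N → ℝ}
    (hf : Continuous f) (hh : Continuous h) (hf' : Continuous f') (hh' : Continuous h')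
    {Bf Bh Bf' Bh' : ℝ} (hBf : ∀ y, ‖f y‖ ≤ Bf) (hBh : ∀ y, ‖h y‖ ≤ Bh) (hBf' : ∀ y, ‖f' y‖ ≤ Bf')
    (hBh' : ∀ y, ‖h' y‖ ≤ Bh') {ε : ℝ} (hε : 0 < ε) (hε1 : ε ≤ 1)
    (hdf : ∫ z, (f z - f' z) ^ 2 ∂((pinnedChain ω₂ lam β γ).gibbsMeasure N T) ≤ ε ^ 2)
    (hdh : ∫ z, (h z - h' z) ^ 2 ∂((pinnedChain ω₂ lam β γ).gibbsMeasure N T) ≤ ε ^ 2)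
    (hcore : (∫ t in Ioi (0 : ℝ), Real.exp (-(lam' * t)) * ∫ z, f' z * (∫ y, h' y
        ∂((pinnedChain ω₂ lam β γ).transitionKernel N T T t.toNNReal z)) ∂((pinnedChain ω₂ lam β γ).gibbsMeasure N T)) =
      ∫ t in Ioi (0 : ℝ), Real.exp (-(lam' * t)) * ∫ z, h' (z.1, -z.2) * (∫ y, f' (y.1, -y.2)
        ∂((pinnedChain ω₂ lam β γ).transitionKernel N T T t.toNNReal z)) ∂((pinnedChain ω₂ lam β γ).gibbsMeasure N T)) :
    |(∫ t in Ioi (0 : ℝ), Real.exp (-(lam' * t)) * ∫ z, f z * (∫ y, h y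
        ∂((pinnedChain ω₂ lam β γ).transitionKernel N T T t.toNNReal z)) ∂((pinnedChain ω₂ lam β γ).gibbsMeasure N T)) -
      ∫ t in Ioi (0 : ℝ), Real.exp (-(lam' * t)) * ∫ z, h (z.1, -z.2) * (∫ y, f (y.1, -y.2)
        ∂((pinnedChain ω₂ lam β γ).transitionKernel N T T t.toNNReal z)) ∂((pinnedChain ω₂ lam β γ).gibbsMeasure N T)| ≤
      (8 + 3 * ∫ z, f z ^ 2 ∂((pinnedChain ω₂ lam β γ).gibbsMeasure N T) +
        3 * ∫ z, h z ^ 2 ∂((pinnedChain ω₂ lam β γ).gibbsMeasure N T)) / 2 / lam' * ε := by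
  haveI : IsProbabilityMeasure ((pinnedChain ω₂ lam β γ).gibbsMeasure N T) :=
    pinnedChain_isProbabilityMeasure_gibbsMeasure hω hl hβ.le γ N hT
  -- flipped data
  have hfΘ : Continuous fun z : PhaseSpace N => f (z.1, -z.2) := continuous_comp_flip hf
  have hhΘ : Continuous fun z : PhaseSpace N => h (z.1, -z.2) := continuous_comp_flip hh
  have hf'Θ : Continuous fun z : PhaseSpace N => f' (z.1, -z.2) := continuous_comp_flip hf'
  have hh'Θ : Continuous fun z : PhaseSpace N => h' (z.1, -z.2) := continuous_comp_flip hh'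
  have hBfΘ : ∀ y : PhaseSpace N, ‖f (y.1, -y.2)‖ ≤ Bf := fun y => hBf _
  have hBhΘ : ∀ y : PhaseSpace N, ‖h (y.1, -y.2)‖ ≤ Bh := fun y => hBh _
  have hBf'Θ : ∀ y : PhaseSpace N, ‖f' (y.1, -y.2)‖ ≤ Bf' := fun y => hBf' _
  have hBh'Θ : ∀ y : PhaseSpace N, ‖h' (y.1, -y.2)‖ ≤ Bh' := fun y => hBh' _
  have hBff' : ∀ y, ‖f y - f' y‖ ≤ Bf + Bf' := fun y => (norm_sub_le _ _).trans (add_le_add (hBf y) (hBf' y))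
  have hBhh' : ∀ y, ‖h y - h' y‖ ≤ Bh + Bh' := fun y => (norm_sub_le _ _).trans (add_le_add (hBh y) (hBh' y))
  have hBhh'Θ : ∀ y : PhaseSpace N, ‖h (y.1, -y.2) - h' (y.1, -y.2)‖ ≤ Bh + Bh' := fun y => hBhh' _
  have hBff'Θ : ∀ y : PhaseSpace N, ‖f (y.1, -y.2) - f' (y.1, -y.2)‖ ≤ Bf + Bf' := fun y => hBff' _
  -- integrals of squares
  have hint_sq : ∀ {g : PhaseSpace N → ℝ}, Continuous g → ∀ {B : ℝ}, (∀ y, ‖g y‖ ≤ B) →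
      Integrable (fun z => g z ^ 2) ((pinnedChain ω₂ lam β γ).gibbsMeasure N T) := fun hg B hB =>
    pinnedChain_integrable_sq_of_bounded hω hl hT hg hB hβ.le
  have hF₂0 : 0 ≤ ∫ z, f z ^ 2 ∂((pinnedChain ω₂ lam β γ).gibbsMeasure N T) := integral_nonneg fun z => sq_nonneg _
  have hH₂0 : 0 ≤ ∫ z, h z ^ 2 ∂((pinnedChain ω₂ lam β γ).gibbsMeasure N T) := integral_nonneg fun z => sq_nonneg _
  have hδ1 : ε ^ 2 ≤ 1 := by nlinarith
  have hf'sq : ∫ z, f' z ^ 2 ∂((pinnedChain ω₂ lam β γ).gibbsMeasure N T) ≤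
      2 * (∫ z, f z ^ 2 ∂((pinnedChain ω₂ lam β γ).gibbsMeasure N T)) + 2 * ε ^ 2 := by
    have i1 : Integrable (fun z => 2 * f z ^ 2) ((pinnedChain ω₂ lam β γ).gibbsMeasure N T) :=
      (hint_sq hf hBf).const_mul 2
    have i2 : Integrable (fun z => 2 * (f z - f' z) ^ 2) ((pinnedChain ω₂ lam β γ).gibbsMeasure N T) :=
      (hint_sq (hf.fun_sub hf') hBff').const_mul 2
    have isum : Integrable (fun z => 2 * f z ^ 2 + 2 * (f z - f' z) ^ 2) ((pinnedChain ω₂ lam β γ).gibbsMeasure N T) :=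
      i1.add i2
    have h1 := integral_mono (hint_sq hf' hBf') isum fun z => by nlinarith [sq_nonneg (2 * f z - f' z)]
    rw [integral_add i1 i2, integral_const_mul, integral_const_mul] at h1
    linarith
  have hh'sq : ∫ z, h' (z.1, -z.2) ^ 2 ∂((pinnedChain ω₂ lam β γ).gibbsMeasure N T) ≤
      2 * (∫ z, h z ^ 2 ∂((pinnedChain ω₂ lam β γ).gibbsMeasure N T)) + 2 * ε ^ 2 := by
    rw [integral_flip_gibbsMeasure (pinnedChain ω₂ lam β γ) N T (fun z => h' z ^ 2)]
    have i1 : Integrable (fun z => 2 * h z ^ 2) ((pinnedChain ω₂ lam β γ).gibbsMeasure N T) :=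
      (hint_sq hh hBh).const_mul 2
    have i2 : Integrable (fun z => 2 * (h z - h' z) ^ 2) ((pinnedChain ω₂ lam β γ).gibbsMeasure N T) :=
      (hint_sq (hh.fun_sub hh') hBhh').const_mul 2
    have isum : Integrable (fun z => 2 * h z ^ 2 + 2 * (h z - h' z) ^ 2) ((pinnedChain ω₂ lam β γ).gibbsMeasure N T) :=
      i1.add i2
    have h1 := integral_mono (hint_sq hh' hBh') isum fun z => by nlinarith [sq_nonneg (2 * h z - h' z)]
    rw [integral_add i1 i2, integral_const_mul, integral_const_mul] at h1
    linarith
  have hfΘsq : ∫ z, f (z.1, -z.2) ^ 2 ∂((pinnedChain ω₂ lam β γ).gibbsMeasure N T) =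
      ∫ z, f z ^ 2 ∂((pinnedChain ω₂ lam β γ).gibbsMeasure N T) :=
    integral_flip_gibbsMeasure (pinnedChain ω₂ lam β γ) N T (fun z => f z ^ 2)
  have hdhΘ : ∫ z, (h (z.1, -z.2) - h' (z.1, -z.2)) ^ 2 ∂((pinnedChain ω₂ lam β γ).gibbsMeasure N T) ≤ ε ^ 2 := by
    rw [integral_flip_gibbsMeasure (pinnedChain ω₂ lam β γ) N T (fun w => (h w - h' w) ^ 2)]; exact hdh
  have hdfΘ : ∫ z, (f (z.1, -z.2) - f' (z.1, -z.2)) ^ 2 ∂((pinnedChain ω₂ lam β γ).gibbsMeasure N T) ≤ ε ^ 2 := by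
    rw [integral_flip_gibbsMeasure (pinnedChain ω₂ lam β γ) N T (fun w => (f w - f' w) ^ 2)]; exact hdf
  -- the four error terms (weighted bounds) and the four additivity identities
  have hεi : 0 < ε⁻¹ := inv_pos.2 hε
  have E1 := pinnedChain_abs_lap_le_weighted hω hl hβ hγ hN hT (hf.fun_sub hf') hh hBff' hBh hlam hεi
  have E2 := pinnedChain_abs_lap_le_weighted hω hl hβ hγ hN hT hf' (hh.fun_sub hh') hBf' hBhh' hlam hε
  have E3 := pinnedChain_abs_lap_le_weighted hω hl hβ hγ hN hT (hhΘ.fun_sub hh'Θ) hfΘ hBhh'Θ hBfΘ hlam hεi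
  have E4 := pinnedChain_abs_lap_le_weighted hω hl hβ hγ hN hT hh'Θ (hfΘ.fun_sub hf'Θ) hBh'Θ hBff'Θ hlam hε
  have S1 := pinnedChain_lap_sub_left hω hl hβ hγ hN hT hf hf' hh hBf hBf' hBh hlam
  have S2 := pinnedChain_lap_sub_right hω hl hβ hγ hN hT hf' hh hh' hBf' hBh hBh' hlam
  have S3 := pinnedChain_lap_sub_left hω hl hβ hγ hN hT hhΘ hh'Θ hfΘ hBhΘ hBh'Θ hBfΘ hlam
  have S4 := pinnedChain_lap_sub_right hω hl hβ hγ hN hT hh'Θ hfΘ hf'Θ hBh'Θ hBfΘ hBf'Θ hlam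
  beta_reduce at E1 E2 E3 E4 S1 S2 S3 S4
  rw [inv_inv] at E1 E3
  -- from the `L²` distances to the numerical bounds
  have X1 : ε⁻¹ * (∫ z, (f z - f' z) ^ 2 ∂((pinnedChain ω₂ lam β γ).gibbsMeasure N T)) ≤ ε := by
    have := mul_le_mul_of_nonneg_left hdf hεi.le
    rwa [show ε⁻¹ * ε ^ 2 = ε by rw [pow_two, ← mul_assoc, inv_mul_cancel₀ hε.ne', one_mul]] at this
  have X2 : ε⁻¹ * (∫ z, (h z - h' z) ^ 2 ∂((pinnedChain ω₂ lam β γ).gibbsMeasure N T)) ≤ ε := by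
    have := mul_le_mul_of_nonneg_left hdh hεi.le
    rwa [show ε⁻¹ * ε ^ 2 = ε by rw [pow_two, ← mul_assoc, inv_mul_cancel₀ hε.ne', one_mul]] at this
  have X3 : ε⁻¹ * (∫ z, (h (z.1, -z.2) - h' (z.1, -z.2)) ^ 2 ∂((pinnedChain ω₂ lam β γ).gibbsMeasure N T)) ≤ ε := by
    have := mul_le_mul_of_nonneg_left hdhΘ hεi.le
    rwa [show ε⁻¹ * ε ^ 2 = ε by rw [pow_two, ← mul_assoc, inv_mul_cancel₀ hε.ne', one_mul]] at this
  have X4 : ε⁻¹ * (∫ z, (f (z.1, -z.2) - f' (z.1, -z.2)) ^ 2 ∂((pinnedChain ω₂ lam β γ).gibbsMeasure N T)) ≤ ε := by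
    have := mul_le_mul_of_nonneg_left hdfΘ hεi.le
    rwa [show ε⁻¹ * ε ^ 2 = ε by rw [pow_two, ← mul_assoc, inv_mul_cancel₀ hε.ne', one_mul]] at this
  have Y2 : ε * (∫ z, f' z ^ 2 ∂((pinnedChain ω₂ lam β γ).gibbsMeasure N T)) ≤
      ε * (2 * (∫ z, f z ^ 2 ∂((pinnedChain ω₂ lam β γ).gibbsMeasure N T)) + 2 * ε ^ 2) :=
    mul_le_mul_of_nonneg_left hf'sq hε.le
  have Y4 : ε * (∫ z, h' (z.1, -z.2) ^ 2 ∂((pinnedChain ω₂ lam β γ).gibbsMeasure N T)) ≤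
      ε * (2 * (∫ z, h z ^ 2 ∂((pinnedChain ω₂ lam β γ).gibbsMeasure N T)) + 2 * ε ^ 2) :=
    mul_le_mul_of_nonneg_left hh'sq hε.le
  rw [hfΘsq] at E3
  -- rewrite `x / 2 / λ` as `x * w`, `w = 1/(2λ) > 0`
  have hw : ∀ x : ℝ, x / 2 / lam' = x * (1 / (2 * lam')) := fun x => by ring
  rw [hw] at E1 E2 E3 E4 ⊢
  have hw0 : 0 < 1 / (2 * lam') := by positivity
  -- combine
  rw [abs_le]
  obtain ⟨E1a, E1b⟩ := abs_le.1 E1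
  obtain ⟨E2a, E2b⟩ := abs_le.1 E2
  obtain ⟨E3a, E3b⟩ := abs_le.1 E3
  obtain ⟨E4a, E4b⟩ := abs_le.1 E4
  have Z1 := mul_le_mul_of_nonneg_right X1 hw0.le
  have Z2 := mul_le_mul_of_nonneg_right X2 hw0.le
  have Z3 := mul_le_mul_of_nonneg_right X3 hw0.le
  have Z4 := mul_le_mul_of_nonneg_right X4 hw0.le
  have Z5 := mul_le_mul_of_nonneg_right Y2 hw0.le
  have Z6 := mul_le_mul_of_nonneg_right Y4 hw0.le
  have Z7 : 0 ≤ ε * (1 / (2 * lam')) * (1 - ε ^ 2) := mul_nonneg (mul_nonneg hε.le hw0.le) (sub_nonneg.2 hδ1)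
  constructor
  · linarith [Z1, Z2, Z3, Z4, Z5, Z6, Z7, hcore, S1, S2, S3, S4, E1a, E2a, E3b, E4b]
  · linarith [Z1, Z2, Z3, Z4, Z5, Z6, Z7, hcore, S1, S2, S3, S4, E1b, E2b, E3a, E4a]

/-- **`B_λ(f,h) = B_λ(h∘Θ, f∘Θ)` for test functions, given density of `(λ - L)C_c^∞`.** For the pinned chain
(`ω₂, β, γ, T > 0`, `lam ≥ 0`, `N ≥ 1`), `λ > 0`, and test functions `f, h`: if every test function `k` is an
`L²(μ_T)`-limit of functions `λb - Lb`, `b ∈ C_c^∞`, then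
`∫₀^∞ e^{-λt} ∫ f · P_t h dμ_T dt = ∫₀^∞ e^{-λt} ∫ (h∘Θ) · P_t(f∘Θ) dμ_T dt`.
[cite: ReyBellet2006, Lemma 4.2] -/
theorem pinnedChain_laplaceDetailedBalance_of_dense {lam' : ℝ} (hlam : 0 < lam')
    (hdense : ∀ k : PhaseSpace N → ℝ, ContDiff ℝ ∞ k → HasCompactSupport k → ∀ δ : ℝ, 0 < δ →
      ∃ b : PhaseSpace N → ℝ, ContDiff ℝ ∞ b ∧ HasCompactSupport b ∧
        ∫ z, (k z - (lam' * b z - (pinnedChain ω₂ lam β γ).generator N T T b z)) ^ 2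
          ∂((pinnedChain ω₂ lam β γ).gibbsMeasure N T) ≤ δ)
    {f h : PhaseSpace N → ℝ} (hf : ContDiff ℝ ∞ f) (hfc : HasCompactSupport f)
    (hh : ContDiff ℝ ∞ h) (hhc : HasCompactSupport h) :
    ∫ t in Ioi (0 : ℝ), Real.exp (-(lam' * t)) * ∫ z, f z * (∫ y, h y
        ∂((pinnedChain ω₂ lam β γ).transitionKernel N T T t.toNNReal z)) ∂((pinnedChain ω₂ lam β γ).gibbsMeasure N T) =
    ∫ t in Ioi (0 : ℝ), Real.exp (-(lam' * t)) * ∫ z, h (z.1, -z.2) * (∫ y, f (y.1, -y.2)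
        ∂((pinnedChain ω₂ lam β γ).transitionKernel N T T t.toNNReal z)) ∂((pinnedChain ω₂ lam β γ).gibbsMeasure N T) := by
  haveI : IsProbabilityMeasure ((pinnedChain ω₂ lam β γ).gibbsMeasure N T) :=
    pinnedChain_isProbabilityMeasure_gibbsMeasure hω hl hβ.le γ N hT
  have hU1 : ContDiff ℝ 1 (pinnedChain ω₂ lam β γ).U := pinnedChain_contDiff_U ω₂ lam β γ
  have hV1 : ContDiff ℝ 1 (pinnedChain ω₂ lam β γ).V := pinnedChain_contDiff_V ω₂ lam β γ
  obtain ⟨Bf, hBf⟩ := hf.continuous.bounded_above_of_compact_support hfc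
  obtain ⟨Bh, hBh⟩ := hh.continuous.bounded_above_of_compact_support hhc
  set K : ℝ := (8 + 3 * ∫ z, f z ^ 2 ∂((pinnedChain ω₂ lam β γ).gibbsMeasure N T) +
    3 * ∫ z, h z ^ 2 ∂((pinnedChain ω₂ lam β γ).gibbsMeasure N T)) / 2 / lam' with hK
  have hK0 : 0 ≤ K := by
    have : 0 ≤ ∫ z, f z ^ 2 ∂((pinnedChain ω₂ lam β γ).gibbsMeasure N T) := integral_nonneg fun z => sq_nonneg _
    have : 0 ≤ ∫ z, h z ^ 2 ∂((pinnedChain ω₂ lam β γ).gibbsMeasure N T) := integral_nonneg fun z => sq_nonneg _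
    positivity
  -- `|LHS - RHS| ≤ K ε` for every `ε ∈ (0,1]`
  have key : ∀ ε : ℝ, 0 < ε → ε ≤ 1 →
      |(∫ t in Ioi (0 : ℝ), Real.exp (-(lam' * t)) * ∫ z, f z * (∫ y, h y
        ∂((pinnedChain ω₂ lam β γ).transitionKernel N T T t.toNNReal z)) ∂((pinnedChain ω₂ lam β γ).gibbsMeasure N T)) -
      ∫ t in Ioi (0 : ℝ), Real.exp (-(lam' * t)) * ∫ z, h (z.1, -z.2) * (∫ y, f (y.1, -y.2)
        ∂((pinnedChain ω₂ lam β γ).transitionKernel N T T t.toNNReal z)) ∂((pinnedChain ω₂ lam β γ).gibbsMeasure N T)|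
        ≤ K * ε := by
    intro ε hε hε1
    have hδ0 : 0 < ε ^ 2 := by positivity
    obtain ⟨b, hb, hbc, hbδ⟩ := hdense h hh hhc (ε ^ 2) hδ0
    obtain ⟨b₂, hb₂, hb₂c, hb₂δ⟩ := hdense (fun z => f (z.1, -z.2)) (contDiff_flip hf)
      (hasCompactSupport_flip hfc) (ε ^ 2) hδ0
    have hb2' : ContDiff ℝ 2 b := hb.of_le (by norm_cast)
    have hb₂2 : ContDiff ℝ 2 b₂ := hb₂.of_le (by norm_cast)
    have hLbc : Continuous ((pinnedChain ω₂ lam β γ).generator N T T b) :=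
      (pinnedChain ω₂ lam β γ).continuous_generator hU1 hV1 N T T hb2'
    have hLb₂c : Continuous ((pinnedChain ω₂ lam β γ).generator N T T b₂) :=
      (pinnedChain ω₂ lam β γ).continuous_generator hU1 hV1 N T T hb₂2
    obtain ⟨Bb, hBb⟩ := hb.continuous.bounded_above_of_compact_support hbc
    obtain ⟨Bb₂, hBb₂⟩ := hb₂.continuous.bounded_above_of_compact_support hb₂c
    obtain ⟨BL, hBL⟩ := hLbc.bounded_above_of_compact_support
      ((pinnedChain ω₂ lam β γ).hasCompactSupport_generator N T T hb2' hbc)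
    obtain ⟨BL₂, hBL₂⟩ := hLb₂c.bounded_above_of_compact_support
      ((pinnedChain ω₂ lam β γ).hasCompactSupport_generator N T T hb₂2 hb₂c)
    -- the approximants `h' = λb - Lb`, `f' = (λb₂ - Lb₂)∘Θ`
    have hh'c : Continuous fun z => lam' * b z - (pinnedChain ω₂ lam β γ).generator N T T b z :=
      (continuous_const.mul hb.continuous).sub hLbc
    have hf'c : Continuous fun z : PhaseSpace N =>
        lam' * b₂ (z.1, -z.2) - (pinnedChain ω₂ lam β γ).generator N T T b₂ (z.1, -z.2) :=
      (continuous_const.mul (continuous_comp_flip hb₂.continuous)).sub (continuous_comp_flip hLb₂c)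
    have hBh' : ∀ y, ‖lam' * b y - (pinnedChain ω₂ lam β γ).generator N T T b y‖ ≤ |lam'| * Bb + BL := fun y => by
      have h1 : ‖lam' * b y‖ ≤ |lam'| * Bb := by
        rw [norm_mul, Real.norm_eq_abs]
        exact mul_le_mul_of_nonneg_left (hBb y) (abs_nonneg _)
      exact (norm_sub_le _ _).trans (add_le_add h1 (hBL y))
    have hBf' : ∀ y : PhaseSpace N, ‖lam' * b₂ (y.1, -y.2) - (pinnedChain ω₂ lam β γ).generator N T T b₂ (y.1, -y.2)‖ ≤
        |lam'| * Bb₂ + BL₂ := fun y => by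
      have h1 : ‖lam' * b₂ (y.1, -y.2)‖ ≤ |lam'| * Bb₂ := by
        rw [norm_mul, Real.norm_eq_abs]
        exact mul_le_mul_of_nonneg_left (hBb₂ _) (abs_nonneg _)
      exact (norm_sub_le _ _).trans (add_le_add h1 (hBL₂ _))
    -- `L²` distances
    have hdf : ∫ z, (f z - (lam' * b₂ (z.1, -z.2) - (pinnedChain ω₂ lam β γ).generator N T T b₂ (z.1, -z.2))) ^ 2
        ∂((pinnedChain ω₂ lam β γ).gibbsMeasure N T) ≤ ε ^ 2 := by
      have e := integral_flip_gibbsMeasure (pinnedChain ω₂ lam β γ) N T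
        (fun w : PhaseSpace N => (f (w.1, -w.2) - (lam' * b₂ w - (pinnedChain ω₂ lam β γ).generator N T T b₂ w)) ^ 2)
      simp only [neg_neg, Prod.mk.eta] at e
      rw [e]
      exact hb₂δ
    -- the core identity on the approximants
    have hcore : (∫ t in Ioi (0 : ℝ), Real.exp (-(lam' * t)) *
        ∫ z, (lam' * b₂ (z.1, -z.2) - (pinnedChain ω₂ lam β γ).generator N T T b₂ (z.1, -z.2)) *
          (∫ y, (lam' * b y - (pinnedChain ω₂ lam β γ).generator N T T b y)
            ∂((pinnedChain ω₂ lam β γ).transitionKernel N T T t.toNNReal z)) ∂((pinnedChain ω₂ lam β γ).gibbsMeasure N T)) =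
        ∫ t in Ioi (0 : ℝ), Real.exp (-(lam' * t)) *
        ∫ z, (lam' * b (z.1, -z.2) - (pinnedChain ω₂ lam β γ).generator N T T b (z.1, -z.2)) *
          (∫ y, (lam' * b₂ ((y.1, -y.2).1, -(y.1, -y.2).2) -
              (pinnedChain ω₂ lam β γ).generator N T T b₂ ((y.1, -y.2).1, -(y.1, -y.2).2))
            ∂((pinnedChain ω₂ lam β γ).transitionKernel N T T t.toNNReal z)) ∂((pinnedChain ω₂ lam β γ).gibbsMeasure N T) := by
      simp only [neg_neg, Prod.mk.eta]
      rw [pinnedChain_lap_resolvent hω hl hβ hγ hN hT hf'c hBf' hb hbc hlam,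
        pinnedChain_lap_resolvent hω hl hβ hγ hN hT (continuous_comp_flip hh'c) (fun y => hBh' _) hb₂ hb₂c hlam]
      -- `∫ f' b dμ = ∫ (h'∘Θ) b₂ dμ`
      have ibd : ∀ {u v : PhaseSpace N → ℝ}, Continuous u → Continuous v → ∀ {Bu Bv : ℝ}, (∀ y, ‖u y‖ ≤ Bu) →
          (∀ y, ‖v y‖ ≤ Bv) → Integrable (fun z => u z * v z) ((pinnedChain ω₂ lam β γ).gibbsMeasure N T) :=
        fun hu hv Bu Bv hBu hBv => (integrable_const (Bu * Bv)).mono' (hu.mul hv).aestronglyMeasurable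
          (Eventually.of_forall fun z => by
            rw [norm_mul]; exact mul_le_mul (hBu z) (hBv z) (norm_nonneg _) ((norm_nonneg _).trans (hBu z)))
      have i1 := ibd (continuous_comp_flip hb₂.continuous) hb.continuous (fun y => hBb₂ _) hBb
      have i2 := ibd (continuous_comp_flip hLb₂c) hb.continuous (fun y => hBL₂ _) hBb
      have i3 := ibd (continuous_comp_flip hb.continuous) hb₂.continuous (fun y => hBb _) hBb₂
      have i4 := ibd (continuous_comp_flip hLbc) hb₂.continuous (fun y => hBL _) hBb₂
      beta_reduce at i1 i2 i3 i4
      have lhs : ∫ z, (lam' * b₂ (z.1, -z.2) - (pinnedChain ω₂ lam β γ).generator N T T b₂ (z.1, -z.2)) * b z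
          ∂((pinnedChain ω₂ lam β γ).gibbsMeasure N T) =
          lam' * (∫ z, b₂ (z.1, -z.2) * b z ∂((pinnedChain ω₂ lam β γ).gibbsMeasure N T)) -
            ∫ z, (pinnedChain ω₂ lam β γ).generator N T T b₂ (z.1, -z.2) * b z ∂((pinnedChain ω₂ lam β γ).gibbsMeasure N T) := by
        rw [← integral_const_mul, ← integral_sub (i1.const_mul lam') i2]
        refine integral_congr_ae (Eventually.of_forall fun z => ?_)
        simp only
        ring
      have rhs : ∫ z, (lam' * b (z.1, -z.2) - (pinnedChain ω₂ lam β γ).generator N T T b (z.1, -z.2)) * b₂ z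
          ∂((pinnedChain ω₂ lam β γ).gibbsMeasure N T) =
          lam' * (∫ z, b (z.1, -z.2) * b₂ z ∂((pinnedChain ω₂ lam β γ).gibbsMeasure N T)) -
            ∫ z, (pinnedChain ω₂ lam β γ).generator N T T b (z.1, -z.2) * b₂ z ∂((pinnedChain ω₂ lam β γ).gibbsMeasure N T) := by
        rw [← integral_const_mul, ← integral_sub (i3.const_mul lam') i4]
        refine integral_congr_ae (Eventually.of_forall fun z => ?_)
        simp only
        ring
      have flip1 : ∫ z, b (z.1, -z.2) * b₂ z ∂((pinnedChain ω₂ lam β γ).gibbsMeasure N T) =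
          ∫ z, b₂ (z.1, -z.2) * b z ∂((pinnedChain ω₂ lam β γ).gibbsMeasure N T) := by
        rw [← integral_flip_gibbsMeasure (pinnedChain ω₂ lam β γ) N T (fun z => b (z.1, -z.2) * b₂ z)]
        refine integral_congr_ae (Eventually.of_forall fun z => ?_)
        simp only [neg_neg, Prod.mk.eta]
        ring
      have flip2 : ∫ z, (pinnedChain ω₂ lam β γ).generator N T T b (z.1, -z.2) * b₂ z ∂((pinnedChain ω₂ lam β γ).gibbsMeasure N T) =
          ∫ z, b₂ (z.1, -z.2) * (pinnedChain ω₂ lam β γ).generator N T T b z ∂((pinnedChain ω₂ lam β γ).gibbsMeasure N T) := by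
        rw [← integral_flip_gibbsMeasure (pinnedChain ω₂ lam β γ) N T
          (fun z => (pinnedChain ω₂ lam β γ).generator N T T b (z.1, -z.2) * b₂ z)]
        refine integral_congr_ae (Eventually.of_forall fun z => ?_)
        simp only [neg_neg, Prod.mk.eta]
        ring
      have stat := pinnedChain_integral_generator_flip_mul (ω₂ := ω₂) (lam := lam) (β := β) hγ hN hT hb₂ hb₂c hb
      rw [lhs, rhs, flip1, flip2, stat]
    have main := pinnedChain_lap_flip_approx hω hl hβ hγ hN hT hlam hf.continuous hh.continuous hf'c hh'c
      hBf hBh hBf' hBh' hε hε1 hdf hbδ hcore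
    rw [hK]
    exact main
  -- conclude
  have hd : |(∫ t in Ioi (0 : ℝ), Real.exp (-(lam' * t)) * ∫ z, f z * (∫ y, h y
        ∂((pinnedChain ω₂ lam β γ).transitionKernel N T T t.toNNReal z)) ∂((pinnedChain ω₂ lam β γ).gibbsMeasure N T)) -
      ∫ t in Ioi (0 : ℝ), Real.exp (-(lam' * t)) * ∫ z, h (z.1, -z.2) * (∫ y, f (y.1, -y.2)
        ∂((pinnedChain ω₂ lam β γ).transitionKernel N T T t.toNNReal z)) ∂((pinnedChain ω₂ lam β γ).gibbsMeasure N T)| ≤ 0 := by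
    refine le_of_forall_pos_le_add fun e he => ?_
    have hε' : 0 < min 1 (e / (K + 1)) := lt_min one_pos (div_pos he (by positivity))
    refine (key _ hε' (min_le_left _ _)).trans ?_
    rw [zero_add]
    calc K * min 1 (e / (K + 1)) ≤ K * (e / (K + 1)) := mul_le_mul_of_nonneg_left (min_le_right _ _) hK0
      _ ≤ e := by
        rw [mul_div_assoc', div_le_iff₀ (by positivity)]
        nlinarith [mul_nonneg hK0 he.le]
  have := abs_nonpos_iff.1 hd
  linarith

end Pinned

/-- Registered anchor `helper_laplaceDetailedBalanceOfDense` of this file (= `pinnedChain_laplaceDetailedBalance_of_dense` in closed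
form): the flipped Laplace identity for test functions, given the density of `(λ - L)C_c^∞`. [cite: ReyBellet2006, Lemma 4.2] -/
theorem helper_laplaceDetailedBalanceOfDense : ∀ ω₂ lam β γ : ℝ, 0 < ω₂ → 0 ≤ lam → 0 < β → 0 < γ → ∀ (N : ℕ), 0 < N → ∀ T : ℝ, 0 < T → ∀ lam' : ℝ, 0 < lam' → (∀ k : PhaseSpace N → ℝ, ContDiff ℝ ((⊤ : ℕ∞) : WithTop ℕ∞) k → HasCompactSupport k → ∀ δ : ℝ, 0 < δ → ∃ b : PhaseSpace N → ℝ, ContDiff ℝ ((⊤ : ℕ∞) : WithTop ℕ∞) b ∧ HasCompactSupport b ∧ ∫ z, (k z - (lam' * b z - (pinnedChain ω₂ lam β γ).generator N T T b z)) ^ 2 ∂((pinnedChain ω₂ lam β γ).gibbsMeasure N T) ≤ δ) → ∀ (f h : PhaseSpace N → ℝ), ContDiff ℝ ((⊤ : ℕ∞) : WithTop ℕ∞) f → HasCompactSupport f → ContDiff ℝ ((⊤ : ℕ∞) : WithTop ℕ∞) h → HasCompactSupport h → (∫ t in Set.Ioi (0 : ℝ), Real.exp (-(lam' * t)) * ∫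 z, f z * (∫ y, h y ∂((pinnedChain ω₂ lam β γ).transitionKernel N T T t.toNNReal z)) ∂((pinnedChain ω₂ lam β γ).gibbsMeasure N T)) = ∫ t in Set.Ioi (0 : ℝ), Real.exp (-(lam' * t)) * ∫ z, h (z.1, -z.2) * (∫ y, f (y.1, -y.2) ∂((pinnedChain ω₂ lam β γ).transitionKernel N T T t.toNNReal z)) ∂((pinnedChain ω₂ lam β γ).gibbsMeasure N T) :=
  fun _ _ _ _ hω hl hβ hγ _ hN _ hT _ hlam hdense _ _ hf hfc hh hhc =>
    pinnedChain_laplaceDetailedBalance_of_dense hω hl hβ hγ hN hT hlam hdense hf hfc hh hhc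

end Summit.AtomisticToContinuum.FouriersLaw.Theorems.SubdiffusiveBondHeat
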